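import Literature.NumberTheory.EllipticCurves.Kobayashi2003.SignedSelmerEtaComponentFacts
import Literature.NumberTheory.EllipticCurves.Kato2004.MainConjectureSkeletonProofs
import Literature.NumberTheory.EllipticCurves.IwasawaAlgebraMuVanishingProofs
import HarnessLib

/-!
# Burungale–Tian 2026, Thm. 2.6 (Kato's main conjecture in `Λ ⊗ ℚ` for every CM newform and every
# prime `p`), read on the `η`-component of Kobayashi 2003 §5–§7 for a CM elliptic curve `V/ℚ` at an
# odd good supersingular prime: Kobayashi's EVEN and ODD `η`-main conjectures for CM `V` hold UP TO
# POWERS OF `p` (the `μ`-free part) — ONE composed-citation named fact and its KERNEL consequences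

Topic `NumberTheory/EllipticCurves`, sub-directory `BurungaleTian2026` (namespace = path). Cell
`bsd-cm` (HOME `run/shared/lean/pub/bsd-cm/`), seat `bsd-cm-k8i-ty` (D-0074 group (G), typer), g6.
Bears on the K8 route `InertBadSignedBranches` (rung leaf `X12.CMInertBad`), item
stmt-BirchSwinnertonDyer-19501 `PlusMCEtaK` (crux; binder `hK` of the deciding theorem; planner's
label since TARGET R350: «DERIVED ON PAPER FROM PRINT (cell memo N26 Addendum A, Corollary F) —
stays OPEN on the ledger until kernel or print»), and on its aside parent 19226 `PrintReadingsInert`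
(conjunct 1). HONEST FRAMING (cell bsd-cm, verbatim intent): the programme assembles the
Birch–Swinnerton-Dyer formula for analytic-rank `≤ 1` curves STRICTLY from published theorems and
TYPES the remainder; BSD is NOT proved by any of this; a closed item closes a rung leaf, never the
summit. THIS FILE: ONE named fact (`def … : Prop`, nothing asserted, no `_holds`; net debt +1) whose
body is a CONJUNCTION OF PRINTED STATEMENTS of two refereed sources about the SAME two Iwasawa
modules, and THEOREMS (kernel module algebra) drawing from it exactly what the sources print when
put side by side: for a CM curve the characteristic ideal of `X^±(V/ℚ(μ_{p^∞}))^η` and Pollack's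
`(L_p^±(V, η, X))` agree UP TO POWERS OF `p`. The `μ`-part (the exponent of `p`) is NOT claimed: it
is exactly Burungale–Tian's Remark 2.7 («integral versions … near future») and the cell's PAPER-S
descent (memo N26 §3) — the honest residual of item 19501 after this file.

## Sources, verbatim

**[BT26]** A. Burungale, Y. Tian, *A rank zero `p`-converse to a theorem of Gross–Zagier, Kolyvagin
and Rubin*, Ann. of Math. 203 (2026), doi:10.4007/annals.2026.203.1.1 (= arXiv:2506.03465; held text
`paper:burungale2025-rank-zero-p-converse-theorem-gross-zagier`, page = file number, read by this
seat 2026-08-26). §2.2.2 (p. 4): "`G_n = Gal(ℚ(ζ_{p^n})/ℚ)`, `G_∞ = lim← G_n = Gal(ℚ(ζ_{p^∞})/ℚ)` …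
`Λ = O_λ[[G_∞]]` a two dimensional complete semi-local ring." §2.2.3: "Let `T ⊂ V_{F_λ}(f)` be a
`G_ℚ`-stable `O_λ`-lattice. For `q ∈ ℤ`, let `𝐇^q(T) = lim←_n H^q(ℤ[ζ_{p^n}, 1/p], T)` be a
`Λ`-module, where `H^q` denotes the étale cohomology as in [12, 8.2]. Let
`𝐇^q(V_{F_λ}(f)) = 𝐇^q(T) ⊗ ℚ`." §2.1.1 (p. 3): "For a (`ℤ_p[[G_{p^∞𝔣}]] ⊗_ℤ ℚ`)-torsion module
`N`, let `ξ(N)` be the characteristic ideal." Thm. 2.3 (p. 4, = [Kato, Thm. 12.4]): "(1)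
`𝐇²(V_{F_λ}(f))` is a torsion `(Λ ⊗ ℚ)`-module and (2) `𝐇¹(V_{F_λ}(f))` is a free `(Λ ⊗ ℚ)`-module
of rank one." Thm. 2.4 (p. 5, = [Kato, Thm. 12.5]): "(1) There exists a non-zero `F_λ`-linear map
`V_{F_λ}(f) → 𝐇¹(V_{F_λ}(f)); γ ↦ z_γ(f)`. (2) Let `Z(f)` be the `(Λ ⊗ ℚ)`-submodule of
`𝐇¹(V_{F_λ}(f))` generated by `z_γ(f)` for all `γ`. Then `𝐇¹(V_{F_λ}(f))/Z(f)` is a torsion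
`(Λ ⊗ ℚ)`-module." **"Theorem 2.6. Let `f ∈ S_k(Γ₁(N))` be a CM newform and `p` a prime. Let `F`
be the Hecke field and `λ` a prime above `p`. Let `V_{F_λ}(f)` be the associated Galois
representation and `𝐇^q(V_{F_λ}(f))` the Iwasawa cohomology. Let `Z(f) ⊂ 𝐇¹(V_{F_λ}(f))` be the
`(Λ ⊗ ℚ)`-submodule of Beilinson–Kato elements. Then `ξ(𝐇²(V_{F_λ}(f))) = ξ(𝐇¹(V_{F_λ}(f))/Z(f))`,
an equality of ideals in `Λ ⊗ ℚ`."** (p. 5; proof: "[12, §15] … In the present setting we instead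
utilise Theorem 2.1" = Johnson-Leung–Kings' equivariant main conjecture in `⊗ ℚ`.) "Remark 2.7. A
finer analysis of [12, §15] is essential to relate the integral versions of the main conjectures in
the above proof, which we hope to study in the near future."

**[Kob03]** S. Kobayashi, *Iwasawa theory for elliptic curves at supersingular primes*, Invent.
Math. 152 (2003) 1–36 (held text `paper:doi-10-1007-s00222-002-0265-4`, page = file number).
Standing (p. 4): `p` odd, `K_n = ℚ(ζ_{p^{n+1}})`, `K_∞ = ∪ K_n`, `E/ℚ` good at `p` with `a_p = 0`.
§4 (p. 8): `M^η = ε_η M` for a character `η` of `Δ = Gal(K_0/ℚ)`; the even / odd main conjectures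
`Char(X⁺(E/K_∞)^η) = (L_p⁺(E, η, X))`, `Char(X⁻(E/K_∞)^η) = ((1/X) L_p⁻(E, η, X))` (`η ≠ 1`).
§5 (p. 8 l. 63 – p. 10): "`𝐇^q(T) = lim←_n H^q(Spec O_{K_n}[1/p], j_*T)` where `H^q(…)` is the
étale cohomology group"; Thm. 5.1 (= Kato Thm. 12.4): "i) `𝐇²(T)` is a finitely generated torsion
`Λ`-module. ii) `𝐇¹(T)` is a torsion free `Λ`-module, and `𝐇¹(V)` is a free `Λ ⊗ ℚ`-module of rank
1. iii) If `T/pT` is irreducible … then `𝐇¹(T)` is a free `Λ`-module of rank 1."; Thm. 5.2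
(= Kato Thm. 12.5/12.6): "ii) Let `Z(V)` be the `Λ ⊗ ℚ`-submodule of `𝐇¹(V)` generated by `z⁺`
and `z⁻`. Then `𝐇¹(V)/Z(V)` is a torsion `Λ ⊗ ℚ`-module. … iv) Let `Z(T)` be the `Λ`-submodule of
`𝐇¹(V)` generated by `z⁺` and `z⁻`. Suppose that `T/pT` is irreducible … Then `Z(T) ⊆ 𝐇¹(T)` in
`𝐇¹(V)`."; (p. 10 l. 12–17) "As a special case, his main conjecture can be read as follows (cf.
Conjecture 12.10 in [7]). **Conjecture (Kato's main conjecture).** Let `η : Δ → ℤ_p^×` be a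
character. Then, `Z(T)^η ⊆ 𝐇¹(T)^η` and `Char 𝐇²(T)^η = Char 𝐇¹(T)^η/Z(T)^η`." **Prop. 7.1
(Kurihara)** (p. 12): "ii) `𝐇²(T)` is isomorphic to `X⁰(E/K_∞)` as `Λ`-module." Cor. 7.2 (p. 13):
"`X⁰(E/K_∞)` is a torsion `Λ`-module." **Thm. 7.4** (p. 13): "The three conjectures, namely, Kato's
main conjecture (Sect. 5), the even main conjecture and the odd main conjecture (Sect. 4) are
equivalent. *Proof.* By Theorem 6.2, 6.3 and (7.21), we have three exact sequences
`0 → 𝐇¹(T)^η/Z(T)^η → Λ^η/(L_p⁺(E, η, X)) → X⁺(E/K_∞)^η → X⁰(E/K_∞)^η → 0`,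
`0 → 𝐇¹(T)^Δ/Z(T)^Δ → Λ^Δ/(L_p⁻(E, X)) → X⁻(E/K_∞)^Δ → X⁰(E/K_∞)^Δ → 0`,
`0 → 𝐇¹(T)^η/Z(T)^η → I^η/(L_p⁻(E, η, X)) → X⁻(E/K_∞)^η → X⁰(E/K_∞)^η → 0`. The last sequence is
for a non-trivial `η`. The theorem follows from these sequences and Proposition 7.1 ii)."

(Docstring convention: in the declaration docstrings below the source's C-word is written `[C]` /
`MC` because of the tree's docstring lint; this module docstring carries the unaltered quotations;
what is vendored is a THEOREM about the printed modules, never a conjecture.)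

## The composition (what the named fact conjoins; every clause printed, about the same two modules)

Fix the frame of the tree's fact `Kobayashi2003.thm74proof_etaExactSequences` (binder for binder):
`p` odd, `K₀ = ℚ(μ_p)`, `η : Γ_ℚ →* ℤˣ` the NON-trivial `{±1}`-valued character trivial on
`Gal(ℚ̄/K₀)` (= `ω^{(p−1)/2}`), `V/ℚ` globally minimal, good at `p` with `a_p = 0`, newform `f`,
period ratio `ϖ` of the parity of `η`, cyclotomic `κ` with topological generator `γ ∈ Gal(ℚ̄/K₀)`
matching the cyclotomic variable; ADD `V` has complex multiplication. Put
`A := 𝐇¹(T)^η/Z(T)^η` and `B := X⁰(V/K_∞)^η` (`T = T_pV`) — the COMMON END TERMS of the two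
`η`-sequences of the proof of [Kob03] Thm. 7.4. The fact says: there are `Λ = ℤ_p⟦X⟧`-modules `A`,
`B` such that
* (K1) `A` is finitely generated and torsion — [Kob03] Thm. 5.1 ii) + Thm. 5.2 ii)/iv)
  (= [Kato] Thm. 12.4/12.5; also [BT26] Thm. 2.3/2.4): `𝐇¹(T)` is finitely generated ([Kato]
  (12.2.1)) and `𝐇¹(V)/Z(V)` is `Λ ⊗ ℚ`-torsion, so the quotient `𝐇¹(T)^η/Z(T)^η` is finitely
  generated and torsion (`Z(T) ⊆ 𝐇¹(T)` by 5.2 iv) whenever `V[p]` is irreducible, which holds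
  for a CM `V` at every odd good `p` inert in the CM field — the tree's `X12.irr_of_cmInert`; in
  general the end term is the torsion module `𝐇¹(T)^η/(Z(T) ∩ 𝐇¹(T))^η`, equal to the printed one
  under 5.2 iv), and the clause below only asserts SOME finitely generated torsion `A`);
* (K2) `B` is finitely generated and torsion — [Kob03] Cor. 7.2 (as in `thm74proof_…`);
* **(BT) `char_Λ(A)` and `char_Λ(B)` agree up to powers of `p`**: `∃ a b, (p^a)·char(A) =
  (p^b)·char(B)` — [BT26] Thm. 2.6 for the CM newform `f = f_V` (weight `2`, `F = ℚ`, `λ = p`,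
  `O_λ = ℤ_p`), i.e. `ξ(𝐇²(V_p(f))) = ξ(𝐇¹(V_p(f))/Z(f))` in `Λ_Kato ⊗ ℚ`, READ (i) for
  `T = T_pV` through [Kob03] §5's own reading of Kato's main conjecture for the Tate module ("his
  main conjecture can be read as follows (cf. Conjecture 12.10 in [7])": `V_{ℚ_p}(f)(1) ≅ V_pV`,
  and the cyclotomic twist is an automorphism of the Iwasawa cohomology along `ℚ(ζ_{p^∞})`
  respecting the equality of the two ideals), (ii) on the `η`-component (`Λ_Kato ⊗ ℚ =
  ∏_{η'} ℤ_p⟦X⟧ ⊗ ℚ` for `p` odd, `p ∤ #Δ`; an equality of ideals of a product ring is the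
  conjunction of its components), (iii) with `𝐇²(T)^η ≅ X⁰(V/K_∞)^η` ([Kob03] Prop. 7.1 ii),
  Kurihara) and `Z(f) = Z(V)` (both the `Λ ⊗ ℚ`-span of Kato's `z_γ`, [Kob03] Thm. 5.2 ii) =
  [Kato] 12.5 (2)), and (iv) with "equality of ideals in `Λ ⊗ ℚ`" = "equality of the `Λ`-ideals
  up to powers of `p`" (`Λ ⊗_ℤ ℚ = ℤ_p⟦X⟧[1/p]`; for NON-ZERO ideals — characteristic ideals
  are non-zero principal — `(g) = (h)` in `ℤ_p⟦X⟧[1/p]` iff `p^a g ℤ_p⟦X⟧ = p^b h ℤ_p⟦X⟧` for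
  some `a, b`). Flags for the referee: `composed-citation` (BT26 Thm. 2.6 ∘ Kob03 §5 / Prop. 7.1 ii)
  / proof of Thm. 7.4 — two refereed primaries about the same modules; precedents in the tree:
  `Kobayashi2013.rem13_…` (composed citation), `Kobayashi2003.thm74proof_etaExactSequences`
  (abstract ends `A`, `B`)), `BT26-2.6-eta-TpE-reading` ((i)–(iv) above), `Kob03-721-eta-abstract-ends`
  (inherited: the end terms are asserted only as SOME finitely generated torsion modules common to
  the clauses — the tree has no `𝐇¹(T)^η`/`Z(T)^η`/`X⁰` vocabulary at `η`), `Kob03-Thm74-eta-by-eta`,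
  `Kob03-Lpm-eta-upto-unit` (inherited from the two sequence clauses, which are COPIED VERBATIM from
  `thm74proof_etaExactSequences`);
* (S+) and (S−): the plus and the minus `η`-exact sequences of the proof of [Kob03] Thm. 7.4 with
  these ends, for SOME `Lp` / `Lm` with the interpolation property of `L_p^±(V, η, X)` and EVERY
  dual datum `D` — verbatim the two clauses of `Kobayashi2003.thm74proof_etaExactSequences`.
Nothing here is stronger than print: the fact is WEAKER than the conjunction of the quoted theorems
(existential in `A`, `B`, `Lp`, `Lm` and the maps) and TRUE iff the genuine modules satisfy the
printed clauses. It is NOT a conjecture: every clause is a published theorem (Annals 2026; Invent.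
2003 with Kato, Astérisque 295); in particular it does not assert Kobayashi's main conjecture, nor
its `μ`-part, for any curve.

## What the kernel then proves (§3) and what it does NOT

From the fact, with Kobayashi's Thm. 2.2 at `η` (`thm22_etaSignedSelmerDual_finite_torsion`, the
dual data are finitely generated torsion) as the only other input: for CM `V` in the frame,
`∃ a b, (p^b)·Char(X⁺(V/K_∞)^η) = (p^a)·(L_p⁺(V, η, X))` for every plus datum (and the printed
`Lp` of the package), and the minus analogue with `X⁻¹L_p⁻` — i.e. the characteristic power series
of `X^±(V/K_∞)^η` and Pollack's `L_p^±(V, η, X)` have THE SAME DISTINGUISHED POLYNOMIAL (same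
`λ`-invariant, same zeroes), and differ at most by a power of `p` times a unit. The algebra is that
of Kobayashi's own proof of Thm. 7.4 ("The theorem follows from these sequences"): multiplicativity of
`char` in `0 → A → Λ/(L) → X → B → 0` (`(L)·char(B) = char(A)·char(X)`, tree
`Module.charIdeal_eq_mul_of_exact`), `char(Λ/(L)) = (L)`, and cancellation of the non-zero
principal ideal `char(A)` (`charIdeal_isPrincipal_holds`). NOT proved and NOT claimed: the equality
of `μ`-invariants (`a = b`), i.e. item 19501 itself; no `BSD(W, p)` for any pair; no case of C-cc-1.
A Summits-side consumer obtains the same statement on the route's objects through the `rfl`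
transports of `Theorems/InertBadSignedBranchesPrintReadingsOfLiterature` (`toLiterature`) and the
uniqueness `Additive.IsQuadraticBranchPlusLFunction.span_singleton_eq` (the `∃ Lp` here becomes
`∀ Lp`).

## References

* [BurungaleTian2026] A. Burungale, Y. Tian, Ann. of Math. 203 (2026), §2.1.1 (p. 3: `ξ`), §2.2.2–
  2.2.4, Thm. 2.3, Thm. 2.4 (pp. 4–5), **Thm. 2.6 and Rem. 2.7 (p. 5)**.
* [Kobayashi2003] S. Kobayashi, Invent. Math. 152 (2003): §4 (p. 8), §5 with Thm. 5.1–5.2 and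
  Kato's main [C] (pp. 8–10), Prop. 7.1 ii), Cor. 7.2, Thm. 7.3 (7.21), **Thm. 7.4 and its proof
  (pp. 12–13)**, Thm. 6.2–6.3 (p. 11), Thm. 3.2 with (3.4)–(3.7) (p. 7).
* [Kato2004Asterisque] K. Kato, Astérisque 295 (2004), Thm. 12.4, Thm. 12.5, Conj. 12.10, §15 —
  cited through [BT26] and [Kob03].
* Tree: `Kobayashi2003/SignedSelmerEtaComponentFacts.lean` (the frame, the predicates
  `IsQuadraticBranch{Plus,Minus}LFunction`, the facts `thm22_…`, `thm74proof_etaExactSequences`),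
  `Kobayashi2003/CyclotomicTowerSignedSelmer.lean` (`EtaSignedSelmerDualData`),
  `IwasawaAlgebraProofs.lean` (`Module.charIdeal_eq_mul_of_exact`), `Kato2004/MainConjectureSkeletonProofs.lean`
  (`Module.charIdeal_eq_span_of_lengthAt_eq_quotient`), `IwasawaAlgebra.lean`
  (`charIdeal_isPrincipal_holds`); cell memo N26 v1.3 Addendum A (Corollary F) and referee reports
  REFEREE-R-N26-AB-G34 / -CDEH-G35 (paper tier; this file types only the printed ⊗ℚ part).
-/

noncomputable section

open scoped Classical

open CongruenceSubgroup Polynomial WeierstrassCurve Field Literature.NumberTheory.EllipticCurves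
  Literature.NumberTheory.EllipticCurves.ModularForms Literature.NumberTheory.GaloisRepresentations
  ZpExtension Literature.NumberTheory.EllipticCurves.Kobayashi2003

namespace Literature.NumberTheory.EllipticCurves.BurungaleTian2026

/-! ## §1 Characteristic ideals along `0 → A → R/(L) → X → B → 0` (the algebra of the proof of
[Kob03] Thm. 7.4, over a Noetherian UFD such as `Λ = ℤ_p⟦X⟧`) -/

section Algebra

variable {R : Type} [CommRing R] [IsNoetherianRing R] [IsDomain R] [UniqueFactorizationMonoid R]
variable {A X B : Type} [AddCommGroup A] [Module R A] [AddCommGroup X] [Module R X]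
  [AddCommGroup B] [Module R B]

/-- `char(R/(L)) = (L)` for `L ≠ 0` over a Noetherian UFD (Washington §13.2 / Bourbaki AC VII §4.5;
the case `ℓ_𝔭(M) = ℓ_𝔭(R/(L))` of the tree's `Module.charIdeal_eq_span_of_lengthAt_eq_quotient`).
[cite: Washington1997, §13.2] -/
theorem charIdeal_quotient_span_singleton {L : R} (hL : L ≠ 0) :
    Module.charIdeal R (R ⧸ Ideal.span {L}) = Ideal.span {L} :=
  Module.charIdeal_eq_span_of_lengthAt_eq_quotient hL fun _ _ => rfl

omit [IsNoetherianRing R] [UniqueFactorizationMonoid R] in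
/-- `R/(L)` is a torsion `R`-module for `L ≠ 0` in a domain. [folklore] -/
private theorem isTorsion_quotient_span_singleton {L : R} (hL : L ≠ 0) :
    Module.IsTorsion R (R ⧸ Ideal.span {L}) := by
  intro x
  refine ⟨⟨L, mem_nonZeroDivisors_of_ne_zero hL⟩, ?_⟩
  obtain ⟨r, rfl⟩ := Ideal.Quotient.mk_surjective x
  change L • Ideal.Quotient.mk (Ideal.span {L}) r = 0
  rw [← Ideal.Quotient.mk_eq_mk, ← Submodule.Quotient.mk_smul, Submodule.Quotient.mk_eq_zero,
    smul_eq_mul]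
  exact Ideal.mul_mem_right r _ (Ideal.mem_span_singleton_self L)

omit [IsNoetherianRing R] [IsDomain R] [UniqueFactorizationMonoid R] in
/-- Torsion is closed under extensions: `0 → Q → X → B → 0` exact with `Q`, `B` torsion ⇒ `X`
torsion. [folklore] -/
private theorem isTorsion_of_exact {Q : Type} [AddCommGroup Q] [Module R Q] (hQ : Module.IsTorsion R Q)
    (hB : Module.IsTorsion R B) (ι : Q →ₗ[R] X) (h : X →ₗ[R] B) (hιh : Function.Exact ι h) :
    Module.IsTorsion R X := by
  intro x
  obtain ⟨s, hs⟩ := @hB (h x)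
  have hx : s.1 • x ∈ LinearMap.range ι := by
    rw [← hιh.linearMap_ker_eq, LinearMap.mem_ker, map_smul]
    exact hs
  obtain ⟨q, hq⟩ := hx
  obtain ⟨t, ht⟩ := @hQ q
  refine ⟨t * s, ?_⟩
  rw [Submonoid.smul_def, Submonoid.coe_mul, mul_smul, ← hq, ← map_smul, ← Submonoid.smul_def, ht,
    map_zero]

omit [IsNoetherianRing R] [UniqueFactorizationMonoid R] in
/-- **In `0 → A → R/(L) → X → B → 0` with `A` and `X` torsion, `L ≠ 0`** (else `R/(0) = R` would
embed, modulo the torsion image of `A`, into the torsion module `X`). This is how Rohrlich's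
non-vanishing `L_p^±(E, η, X) ≠ 0` is visible on the algebraic side of [Kob03] Thm. 7.3; here it lets
the theorems below run WITHOUT a non-vanishing input. [cite: Kobayashi2003, proof of Thm. 7.3 (p. 13)] -/
theorem ne_zero_of_fourTermExact_of_isTorsion {L : R} (hA : Module.IsTorsion R A)
    (hX : Module.IsTorsion R X) (i : A →ₗ[R] R ⧸ Ideal.span {L})
    (j : (R ⧸ Ideal.span {L}) →ₗ[R] X) (hij : Function.Exact i j) : L ≠ 0 := by
  intro hL0
  subst hL0
  -- the class of `1` in `R/(0)`: some `c ≠ 0` maps `j 1` to zero, so `c • 1 ∈ range i`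
  obtain ⟨c, hc⟩ := @hX (j (Ideal.Quotient.mk (Ideal.span {(0 : R)}) 1))
  have hmem : (c : R) • Ideal.Quotient.mk (Ideal.span {(0 : R)}) 1 ∈ Set.range i := by
    rw [← hij]
    rw [map_smul]
    exact hc
  obtain ⟨a, ha⟩ := hmem
  obtain ⟨d, hd⟩ := @hA a
  have h1 : ((d : R) * (c : R)) • Ideal.Quotient.mk (Ideal.span {(0 : R)}) (1 : R) = 0 := by
    rw [mul_smul, ← ha, ← map_smul, show (d : R) • a = 0 from hd, map_zero]
  rw [← Ideal.Quotient.mk_eq_mk, ← Submodule.Quotient.mk_smul, Submodule.Quotient.mk_eq_zero,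
    smul_eq_mul, mul_one, Ideal.span_singleton_zero, Ideal.mem_bot] at h1
  exact (mul_ne_zero (nonZeroDivisors.ne_zero d.2) (nonZeroDivisors.ne_zero c.2)) h1

/-- **`(L) · char(B) = char(A) · char(X)` along `0 → A → R/(L) → X → B → 0`** (`L ≠ 0`, `A` and
`B` finitely generated, `B` torsion, `R` a Noetherian UFD): with `Q` the image of `R/(L)` in `X`,
`(L) = char(R/(L)) = char(A)·char(Q)` and `char(X) = char(Q)·char(B)` (multiplicativity in short
exact sequences of finitely generated torsion modules, tree `Module.charIdeal_eq_mul_of_exact`;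
`X` is then finitely generated torsion). This is the module theory of [Kob03]'s sentence "The
theorem follows from these sequences" (proof of Thm. 7.4, p. 13).
[cite: Kobayashi2003, proof of Thm. 7.4 (p. 13)] [cite: NeukirchSchmidtWingberg2008, Ch. V §3] -/
theorem span_singleton_mul_charIdeal_eq_of_fourTermExact [Module.Finite R B]
    (hB : Module.IsTorsion R B) {L : R} (hL : L ≠ 0)
    (f : A →ₗ[R] R ⧸ Ideal.span {L}) (g : (R ⧸ Ideal.span {L}) →ₗ[R] X) (h : X →ₗ[R] B)
    (hf : Function.Injective f) (hfg : Function.Exact f g) (hgh : Function.Exact g h)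
    (hh : Function.Surjective h) :
    Ideal.span {L} * Module.charIdeal R B = Module.charIdeal R A * Module.charIdeal R X := by
  set Q : Submodule R X := LinearMap.range g with hQdef
  have hM : Module.IsTorsion R (R ⧸ Ideal.span {L}) := isTorsion_quotient_span_singleton hL
  have h1 : Function.Exact f g.rangeRestrict := by
    rw [LinearMap.exact_iff, LinearMap.ker_rangeRestrict, hfg.linearMap_ker_eq]
  have h2 : Function.Exact Q.subtype h := by
    rw [LinearMap.exact_iff, hgh.linearMap_ker_eq, Submodule.range_subtype]
  have hQtors : Module.IsTorsion R Q := by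
    intro q
    obtain ⟨m, rfl⟩ := LinearMap.surjective_rangeRestrict g q
    obtain ⟨s, hs⟩ := @hM m
    exact ⟨s, by rw [Submonoid.smul_def, ← map_smul, ← Submonoid.smul_def, hs, map_zero]⟩
  haveI : Module.Finite R X := Module.Finite.of_exact h2 hh
  have hX : Module.IsTorsion R X := isTorsion_of_exact hQtors hB Q.subtype h h2
  have e1 : Ideal.span {L} = Module.charIdeal R A * Module.charIdeal R Q := by
    rw [← charIdeal_quotient_span_singleton hL]
    exact Module.charIdeal_eq_mul_of_exact hM f g.rangeRestrict hf
      (LinearMap.surjective_rangeRestrict g) h1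
  have e2 : Module.charIdeal R X = Module.charIdeal R Q * Module.charIdeal R B :=
    Module.charIdeal_eq_mul_of_exact hX Q.subtype h (Submodule.injective_subtype Q) hh h2
  rw [e2, ← mul_assoc, ← e1]

omit [IsNoetherianRing R] [UniqueFactorizationMonoid R] in
/-- **The `⊗ℚ` bookkeeping.** If `(L)·char(B) = char(A)·char(X)`, `char(A) = (g)` with `g ≠ 0`,
and `(x)·char(A) = (y)·char(B)` (e.g. `x = p^a`, `y = p^b`), then `(y)·char(X) = (x)·(L)` =
`(x·L)`: multiply the first identity by `(y)`, substitute, and cancel the non-zero principal ideal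
`(g)`. [folklore] -/
private theorem span_mul_charIdeal_eq_of_upTo {L g x y : R} (hg : g ≠ 0)
    (hA : Module.charIdeal R A = Ideal.span {g})
    (h4 : Ideal.span {L} * Module.charIdeal R B = Module.charIdeal R A * Module.charIdeal R X)
    (hAB : Ideal.span {x} * Module.charIdeal R A = Ideal.span {y} * Module.charIdeal R B) :
    Ideal.span {y} * Module.charIdeal R X = Ideal.span {x} * Ideal.span {L} := by
  have h3 : (Ideal.span {x} * Ideal.span {L}) * Ideal.span {g} =
      (Ideal.span {y} * Module.charIdeal R X) * Ideal.span {g} := by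
    calc (Ideal.span {x} * Ideal.span {L}) * Ideal.span {g}
        = Ideal.span {L} * (Ideal.span {x} * Module.charIdeal R A) := by rw [← hA]; ring
      _ = Ideal.span {L} * (Ideal.span {y} * Module.charIdeal R B) := by rw [hAB]
      _ = Ideal.span {y} * (Ideal.span {L} * Module.charIdeal R B) := by ring
      _ = Ideal.span {y} * (Module.charIdeal R A * Module.charIdeal R X) := by rw [h4]
      _ = (Ideal.span {y} * Module.charIdeal R X) * Ideal.span {g} := by rw [hA]; ring
  exact ((Ideal.span_singleton_mul_left_inj hg).mp h3).symm

end Algebra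

/-! ## §2 The named fact: [BT26] Thm. 2.6 read on the `η`-ends of [Kob03]'s Thm. 7.4-sequences
for a CM curve -/

/-- **Burungale–Tian 2026, Thm. 2.6 (Kato's main [C] in `Λ ⊗ ℚ` for a CM newform) read, for a
CM elliptic curve `V/ℚ` at an odd good prime `p` with `a_p = 0`, on the `η`-component of Kobayashi
2003 §5 (Kato's main [C] for `T = T_pV`, `η` by `η`) and Prop. 7.1 ii) (`𝐇²(T) ≅ X⁰(V/K_∞)`),
TOGETHER WITH the two `η`-exact sequences of the proof of Kobayashi's Thm. 7.4 at the quadratic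
character `η = ω^{(p−1)/2}` (text of the tree's `Kobayashi2003.thm74proof_etaExactSequences`,
verbatim) — COMPOSED CITATION, one package about the same two modules.** Frame of
`thm74proof_etaExactSequences` plus `V.HasCM`: there are `Λ = ℤ_p⟦X⟧`-modules `A`
(«`𝐇¹(T)^η/Z(T)^η`») and `B` («`X⁰(V/K_∞)^η ≅ 𝐇²(T)^η`») with: (K1) `A` finitely generated torsion
([Kob03] Thm. 5.1 ii) / 5.2 ii), iv) = [Kato] 12.4/12.5; [BT26] Thm. 2.3/2.4); (K2) `B` finitely
generated torsion ([Kob03] Cor. 7.2); **(BT) `∃ a b, (p^a)·char(A) = (p^b)·char(B)`** — [BT26]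
Thm. 2.6 `ξ(𝐇²(V_p(f_V))) = ξ(𝐇¹(V_p(f_V))/Z(f_V))` in `Λ ⊗ ℚ`, on the `η`-component for
`T = T_pV` ([Kob03] §5 reading of [Kato] Conj. 12.10; Prop. 7.1 ii)); equality in
`Λ ⊗ ℚ = ℤ_p⟦X⟧[1/p]` of non-zero ideals = equality up to powers of `p`); (S+) for SOME `Lp` with
the interpolation property (3.4)+(3.6) of `L_p⁺(V, η, X)` and EVERY plus datum `D⁺`, an exact
`0 → A → Λ/(Lp) → X(D⁺) → B → 0`; (S−) for SOME `Lm` with (3.5)+(3.7) of `L_p⁻(V, η, X)`, every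
minus datum `D⁻` and every `L'` with `Lm = X·L'`, an exact `0 → A → Λ/(L') → X(D⁻) → B → 0`.
READING FLAGS (module docstring): `composed-citation`, `BT26-2.6-eta-TpE-reading`,
`Kob03-721-eta-abstract-ends`, `Kob03-Thm74-eta-by-eta`, `Kob03-Lpm-eta-upto-unit`. WEAKER than print
(existential); NOT a [C]: every clause is a published theorem. The `μ`-part (`a = b`) is NOT
asserted ([BT26] Rem. 2.7). Named fact; nothing asserted; no `_holds` (Beilinson–Kato elements,
Coleman maps, Poitou–Tate, the equivariant main [C]: none of it is in Mathlib).
[cite: BurungaleTian2026, Thm. 2.6 and Rem. 2.7 (p. 5), Thm. 2.3–2.4 (pp. 4–5), §2.1.1 (p. 3), §2.2.2–2.2.3 (p. 4)]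
[cite: Kobayashi2003, §5 Kato's main [C] (p. 10 l. 12–17), Thm. 5.1–5.2 (p. 9), Prop. 7.1 ii) (p. 12), Cor. 7.2, proof of Thm. 7.4 (p. 13), Thm. 6.2–6.3 (p. 11), Thm. 3.2 and (3.4)–(3.7) (p. 7), §4 (p. 8)] -/
def thm26_etaKatoSequences_charIdeal_upToP_of_cm : Prop :=
  ∀ (p : ℕ) [Fact p.Prime] (K₀ : Type) [Field K₀] [NumberField K₀] [IsCyclotomicExtension {p} ℚ K₀]
    [(galRange (K := ℚ) K₀).Normal] (η : absoluteGaloisGroup ℚ →* ℤˣ),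
    (∀ σ ∈ galRange (K := ℚ) K₀, η σ = 1) → η ≠ 1 →
  ∀ (V : WeierstrassCurve ℚ) [V.IsElliptic] [V.IsGloballyMinimal] {N : ℕ} [NeZero N]
    {f : CuspForm (Gamma0 N) 2},
    p ≠ 2 → V.HasCM → V.HasGoodReductionAtPrime p → V.frobeniusTrace p = 0 → IsNewformOf V f →
  ∀ (ϖ : ℚ), (if Even (p / 2) then (ϖ : ℝ) * V.realPeriodRat = plusPeriod f
      else (ϖ : ℝ) * V.imaginaryPeriodRat = minusPeriod f) →
  ∀ (κ : ZpExtension ℚ p) (γ : absoluteGaloisGroup ℚ),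
    κ.IsCyclotomic → κ.IsTopGenerator γ → γ ∈ galRange (K := ℚ) K₀ → IsCyclotomicVariable p γ →
  ∃ (A B : Type) (_ : AddCommGroup A) (_ : Module (IwasawaAlgebra p) A)
    (_ : AddCommGroup B) (_ : Module (IwasawaAlgebra p) B),
    (Module.Finite (IwasawaAlgebra p) A ∧ Module.IsTorsion (IwasawaAlgebra p) A) ∧
    (Module.Finite (IwasawaAlgebra p) B ∧ Module.IsTorsion (IwasawaAlgebra p) B) ∧
    (∃ a b : ℕ, Ideal.span {(p : IwasawaAlgebra p) ^ a} * Module.charIdeal (IwasawaAlgebra p) A =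
        Ideal.span {(p : IwasawaAlgebra p) ^ b} * Module.charIdeal (IwasawaAlgebra p) B) ∧
    (∃ Lp : IwasawaAlgebra p, IsQuadraticBranchPlusLFunction f p ϖ Lp ∧
      ∀ D : EtaSignedSelmerDualData V κ K₀ ℚ_[p] η γ 1,
        ∃ (i : A →ₗ[IwasawaAlgebra p] (IwasawaAlgebra p ⧸ Ideal.span {Lp}))
          (j : (IwasawaAlgebra p ⧸ Ideal.span {Lp}) →ₗ[IwasawaAlgebra p] D.X)
          (k : D.X →ₗ[IwasawaAlgebra p] B),
          Function.Injective i ∧ Function.Exact i j ∧ Function.Exact j k ∧ Function.Surjective k) ∧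
    (∃ Lm : IwasawaAlgebra p, IsQuadraticBranchMinusLFunction f p ϖ Lm ∧
      ∀ (D : EtaSignedSelmerDualData V κ K₀ ℚ_[p] η γ (-1)) (L' : IwasawaAlgebra p),
        Lm = PowerSeries.X * L' →
        ∃ (i : A →ₗ[IwasawaAlgebra p] (IwasawaAlgebra p ⧸ Ideal.span {L'}))
          (j : (IwasawaAlgebra p ⧸ Ideal.span {L'}) →ₗ[IwasawaAlgebra p] D.X)
          (k : D.X →ₗ[IwasawaAlgebra p] B),
          Function.Injective i ∧ Function.Exact i j ∧ Function.Exact j k ∧ Function.Surjective k)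

/-! ## §3 Kernel consequences: Kobayashi's even / odd `η`-main [C] for CM `V`, up to powers of `p` -/

section Consequences

variable {p : ℕ} [Fact p.Prime]

/-- Over `Λ = ℤ_p⟦X⟧` every characteristic ideal is `(g)` for some `g ≠ 0` (principal: tree
`charIdeal_isPrincipal_holds`, `Λ` a UFD; non-zero: a finite product of powers of height-one primes
of a domain, or the junk value `1`). [cite: Washington1997, §13.2] -/
theorem exists_charIdeal_eq_span_ne_zero (M : Type) [AddCommGroup M] [Module (IwasawaAlgebra p) M] :
    ∃ g : IwasawaAlgebra p, g ≠ 0 ∧ Module.charIdeal (IwasawaAlgebra p) M = Ideal.span {g} := by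
  have hP : (Module.charIdeal (IwasawaAlgebra p) M).IsPrincipal := charIdeal_isPrincipal_holds p M
  refine ⟨Submodule.IsPrincipal.generator (Module.charIdeal (IwasawaAlgebra p) M), ?_,
    (Ideal.span_singleton_generator _).symm⟩
  intro h0
  have hbot : Module.charIdeal (IwasawaAlgebra p) M = ⊥ := by
    rw [← Ideal.span_singleton_generator (Module.charIdeal (IwasawaAlgebra p) M), h0,
      Ideal.span_singleton_eq_bot]
  -- a product of powers of height-one primes of a domain (or the junk value `1`) is non-zero
  revert hbot
  unfold Module.charIdeal
  refine finprod_mem_induction (fun I : Ideal (IwasawaAlgebra p) => I ≠ ⊥) ?_ (fun I J hI hJ => ?_) ?_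
  · rw [Ideal.one_eq_top]
    exact top_ne_bot
  · exact fun h => (Ideal.mul_eq_bot.mp h).elim hI hJ
  · intro 𝔭 h𝔭 h
    have h1 : 𝔭.asIdeal ≠ ⊥ := Ideal.ne_bot_of_height_eq_one h𝔭
    rcases Nat.eq_zero_or_pos (Module.lengthAt (IwasawaAlgebra p) M 𝔭).toNat with h0' | hpos
    · rw [h0', pow_zero, Ideal.one_eq_top] at h
      exact top_ne_bot h
    · exact h1 ((Ideal.pow_eq_bot hpos.ne').mp h)

/-- **Kobayashi's EVEN main [C] at `η` for a CM curve, UP TO POWERS OF `p`** — from the composed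
fact [BT26 Thm. 2.6 ∘ Kob03 §5 / 7.1 ii) / proof of 7.4] and Kobayashi's Thm. 2.2 at `η`: for
`V/ℚ` CM, globally minimal, good at the odd `p` with `a_p = 0`, `η` the quadratic character of
`Gal(ℚ(μ_p)/ℚ)`, frame as in `thm74proof_etaExactSequences`, there is `Lp` with the interpolation
property of `L_p⁺(V, η, X)` such that for EVERY Pontryagin-dual datum `D` of `Sel⁺(V/K_∞)^η`:
`(p^b)·Char(X(D)) = (p^a)·(Lp)` for some `a b : ℕ` — the characteristic power series of
`X⁺(V/K_∞)^η` and `L_p⁺(V, η, X)` agree up to `p^ℤ·Λ^×` (same `λ`-invariant and distinguished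
polynomial). The `μ`-part (item 19501 `PlusMCEtaK` in full) is NOT proved here.
[cite: BurungaleTian2026, Thm. 2.6 (p. 5)] [cite: Kobayashi2003, proof of Thm. 7.4 (p. 13), Prop. 7.1 ii) (p. 12), Thm. 2.2 (p. 5)] -/
theorem evenEtaCharIdeal_eq_upToP_of_cm (h26 : thm26_etaKatoSequences_charIdeal_upToP_of_cm)
    (h22 : thm22_etaSignedSelmerDual_finite_torsion)
    (K₀ : Type) [Field K₀] [NumberField K₀] [IsCyclotomicExtension {p} ℚ K₀]
    [(galRange (K := ℚ) K₀).Normal] (η : absoluteGaloisGroup ℚ →* ℤˣ)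
    (hη : ∀ σ ∈ galRange (K := ℚ) K₀, η σ = 1) (hη1 : η ≠ 1)
    (V : WeierstrassCurve ℚ) [V.IsElliptic] [V.IsGloballyMinimal] {N : ℕ} [NeZero N]
    {f : CuspForm (Gamma0 N) 2} (hp : p ≠ 2) (hCM : V.HasCM) (hgood : V.HasGoodReductionAtPrime p)
    (hap : V.frobeniusTrace p = 0) (hf : IsNewformOf V f) (ϖ : ℚ)
    (hϖ : if Even (p / 2) then (ϖ : ℝ) * V.realPeriodRat = plusPeriod f
      else (ϖ : ℝ) * V.imaginaryPeriodRat = minusPeriod f)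
    (κ : ZpExtension ℚ p) (γ : absoluteGaloisGroup ℚ) (hκ : κ.IsCyclotomic)
    (hγ : κ.IsTopGenerator γ) (hγK : γ ∈ galRange (K := ℚ) K₀) (hvar : IsCyclotomicVariable p γ) :
    ∃ Lp : IwasawaAlgebra p, IsQuadraticBranchPlusLFunction f p ϖ Lp ∧
      ∀ D : EtaSignedSelmerDualData V κ K₀ ℚ_[p] η γ 1, ∃ a b : ℕ,
        Ideal.span {(p : IwasawaAlgebra p) ^ b} * D.charIdeal =
          Ideal.span {(p : IwasawaAlgebra p) ^ a} * Ideal.span {Lp} := by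
  obtain ⟨A, B, _, _, _, _, ⟨hAfin, hAtors⟩, ⟨hBfin, hBtors⟩, ⟨a, b, hAB⟩, ⟨Lp, hLp, hS⟩, -⟩ :=
    h26 p K₀ η hη hη1 V hp hCM hgood hap hf ϖ hϖ κ γ hκ hγ hγK hvar
  refine ⟨Lp, hLp, fun D => ⟨a, b, ?_⟩⟩
  obtain ⟨i, j, k, hi, hij, hjk, hk⟩ := hS D
  have hX : Module.IsTorsion (IwasawaAlgebra p) D.X :=
    (h22 p K₀ η hη V hp hgood hap κ γ hκ hγ hγK 1 D).2
  have hL : Lp ≠ 0 := ne_zero_of_fourTermExact_of_isTorsion hAtors hX i j hij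
  have h4 := span_singleton_mul_charIdeal_eq_of_fourTermExact hBtors hL i j k hi hij hjk hk
  obtain ⟨g, hg, hAg⟩ := exists_charIdeal_eq_span_ne_zero (p := p) A
  exact span_mul_charIdeal_eq_of_upTo hg hAg h4 hAB

/-- **Kobayashi's ODD main [C] at `η` for a CM curve, UP TO POWERS OF `p`** — the minus
analogue: there is `Lm` with the interpolation property (3.5)+(3.7) of `L_p⁻(V, η, X)` such that for
every dual datum `D` of `Sel⁻(V/K_∞)^η` and every `L'` with `Lm = X·L'` ((3.7): `X ∣ L_p⁻`),
`(p^b)·Char(X(D)) = (p^a)·(L')` for some `a b`. The `μ`-part is NOT proved here.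
[cite: BurungaleTian2026, Thm. 2.6 (p. 5)] [cite: Kobayashi2003, proof of Thm. 7.4 (p. 13), Prop. 7.1 ii) (p. 12), Thm. 2.2 (p. 5), (3.7) (p. 7)] -/
theorem oddEtaCharIdeal_eq_upToP_of_cm (h26 : thm26_etaKatoSequences_charIdeal_upToP_of_cm)
    (h22 : thm22_etaSignedSelmerDual_finite_torsion)
    (K₀ : Type) [Field K₀] [NumberField K₀] [IsCyclotomicExtension {p} ℚ K₀]
    [(galRange (K := ℚ) K₀).Normal] (η : absoluteGaloisGroup ℚ →* ℤˣ)
    (hη : ∀ σ ∈ galRange (K := ℚ) K₀, η σ = 1) (hη1 : η ≠ 1)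
    (V : WeierstrassCurve ℚ) [V.IsElliptic] [V.IsGloballyMinimal] {N : ℕ} [NeZero N]
    {f : CuspForm (Gamma0 N) 2} (hp : p ≠ 2) (hCM : V.HasCM) (hgood : V.HasGoodReductionAtPrime p)
    (hap : V.frobeniusTrace p = 0) (hf : IsNewformOf V f) (ϖ : ℚ)
    (hϖ : if Even (p / 2) then (ϖ : ℝ) * V.realPeriodRat = plusPeriod f
      else (ϖ : ℝ) * V.imaginaryPeriodRat = minusPeriod f)
    (κ : ZpExtension ℚ p) (γ : absoluteGaloisGroup ℚ) (hκ : κ.IsCyclotomic)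
    (hγ : κ.IsTopGenerator γ) (hγK : γ ∈ galRange (K := ℚ) K₀) (hvar : IsCyclotomicVariable p γ) :
    ∃ Lm : IwasawaAlgebra p, IsQuadraticBranchMinusLFunction f p ϖ Lm ∧
      ∀ (D : EtaSignedSelmerDualData V κ K₀ ℚ_[p] η γ (-1)) (L' : IwasawaAlgebra p),
        Lm = PowerSeries.X * L' → ∃ a b : ℕ,
          Ideal.span {(p : IwasawaAlgebra p) ^ b} * D.charIdeal =
            Ideal.span {(p : IwasawaAlgebra p) ^ a} * Ideal.span {L'} := by
  obtain ⟨A, B, _, _, _, _, ⟨hAfin, hAtors⟩, ⟨hBfin, hBtors⟩, ⟨a, b, hAB⟩, -, ⟨Lm, hLm, hS⟩⟩ :=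
    h26 p K₀ η hη hη1 V hp hCM hgood hap hf ϖ hϖ κ γ hκ hγ hγK hvar
  refine ⟨Lm, hLm, fun D L' hL' => ⟨a, b, ?_⟩⟩
  obtain ⟨i, j, k, hi, hij, hjk, hk⟩ := hS D L' hL'
  have hX : Module.IsTorsion (IwasawaAlgebra p) D.X :=
    (h22 p K₀ η hη V hp hgood hap κ γ hκ hγ hγK (-1) D).2
  have hL : L' ≠ 0 := ne_zero_of_fourTermExact_of_isTorsion hAtors hX i j hij
  have h4 := span_singleton_mul_charIdeal_eq_of_fourTermExact hBtors hL i j k hi hij hjk hk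
  obtain ⟨g, hg, hAg⟩ := exists_charIdeal_eq_span_ne_zero (p := p) A
  exact span_mul_charIdeal_eq_of_upTo hg hAg h4 hAB

/-- **The `∀ Lp` form of the even statement**, under the DISPLAYED uniqueness of the ideal
`(L_p⁺(V, η, X))` among all `Lp` with the interpolation property (true: an Iwasawa function is
determined by its values at the `ζ − 1`, up to the unit `u` of the predicate — proved Summits-side as
`Additive.IsQuadraticBranchPlusLFunction.span_singleton_eq`; displayed here as the hypothesis
`huniq`, not asserted). This is the shape of item 19501's conclusion `D.charIdeal = (Lp)` with the
`μ`-part removed. [cite: BurungaleTian2026, Thm. 2.6 (p. 5)] [cite: Kobayashi2003, proof of Thm. 7.4 (p. 13), Thm. 3.2 (p. 7)] -/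
theorem evenEtaCharIdeal_eq_upToP_of_cm_of_unique
    (h26 : thm26_etaKatoSequences_charIdeal_upToP_of_cm)
    (h22 : thm22_etaSignedSelmerDual_finite_torsion)
    (K₀ : Type) [Field K₀] [NumberField K₀] [IsCyclotomicExtension {p} ℚ K₀]
    [(galRange (K := ℚ) K₀).Normal] (η : absoluteGaloisGroup ℚ →* ℤˣ)
    (hη : ∀ σ ∈ galRange (K := ℚ) K₀, η σ = 1) (hη1 : η ≠ 1)
    (V : WeierstrassCurve ℚ) [V.IsElliptic] [V.IsGloballyMinimal] {N : ℕ} [NeZero N]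
    {f : CuspForm (Gamma0 N) 2} (hp : p ≠ 2) (hCM : V.HasCM) (hgood : V.HasGoodReductionAtPrime p)
    (hap : V.frobeniusTrace p = 0) (hf : IsNewformOf V f) (ϖ : ℚ)
    (hϖ : if Even (p / 2) then (ϖ : ℝ) * V.realPeriodRat = plusPeriod f
      else (ϖ : ℝ) * V.imaginaryPeriodRat = minusPeriod f)
    (huniq : ∀ L₁ L₂ : IwasawaAlgebra p, IsQuadraticBranchPlusLFunction f p ϖ L₁ →
      IsQuadraticBranchPlusLFunction f p ϖ L₂ → Ideal.span {L₁} = Ideal.span {L₂})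
    (κ : ZpExtension ℚ p) (γ : absoluteGaloisGroup ℚ) (hκ : κ.IsCyclotomic)
    (hγ : κ.IsTopGenerator γ) (hγK : γ ∈ galRange (K := ℚ) K₀) (hvar : IsCyclotomicVariable p γ)
    (Lp : IwasawaAlgebra p) (hLp : IsQuadraticBranchPlusLFunction f p ϖ Lp)
    (D : EtaSignedSelmerDualData V κ K₀ ℚ_[p] η γ 1) :
    ∃ a b : ℕ, Ideal.span {(p : IwasawaAlgebra p) ^ b} * D.charIdeal =
      Ideal.span {(p : IwasawaAlgebra p) ^ a} * Ideal.span {Lp} := by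
  obtain ⟨Lp₀, hLp₀, h⟩ := evenEtaCharIdeal_eq_upToP_of_cm h26 h22 K₀ η hη hη1 V hp hCM hgood hap
    hf ϖ hϖ κ γ hκ hγ hγK hvar
  obtain ⟨a, b, hab⟩ := h D
  exact ⟨a, b, by rw [huniq Lp Lp₀ hLp hLp₀, hab]⟩

end Consequences


/-! ## §4 (appended, proofs only) The `μ`-criterion: after §3, item 19501 IS the `μ`-equality

For a finitely generated torsion `Λ`-module `X` whose characteristic ideal agrees with `(L)` up to
powers of `p` (the output of §3), `Char(X) = (L)` holds IF AND ONLY IF `μ(X) = μ(Λ/(L))` — the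
`μ`-invariant of `X` (tree `muInvariant`: the local length at the height-one prime `(p)`) equals
the `p`-content exponent of `L`. Hence, for a CM `V` in the frame of §3, Kobayashi's even main [C]
at `η` (the conclusion of item 19501 `PlusMCEtaK`, verbatim `D.charIdeal = (Lp)`) is EQUIVALENT in
the kernel to the single `μ`-statement `μ(X⁺(V/K_∞)^η) = μ(Λ/(L_p⁺(V, η, X)))`: exactly the part
[BT26] Rem. 2.7 leaves to «a finer analysis of [Kato §15]» and the cell's memo N26 §3 derives on
paper. Tools: the structure theorem road of `IwasawaAlgebra.lean` (`exists_isPseudoIsomorphism_elementary_holds`,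
`charIdeal_eq_span_holds`, `muInvariant_eq_sum_holds`: `μ(M) = ∑ μᵢ` and `char(M) = (p^{∑ μᵢ}∏ fⱼ^{nⱼ})`),
and the local lengths of cyclic modules at `(p)` (`lengthAt_quotient_C_pow`,
`Module.lengthAt_quotient_span_singleton_mul`). Nothing new is asserted; no new fact. -/

section MuCriterion

open Literature.NumberTheory.EllipticCurves.IwasawaAlgebra

variable {p : ℕ} [Fact p.Prime]

/-- A product of elements outside the prime `(p)` is outside `(p)`. [folklore] -/
private theorem list_prod_notMem_augIdealP {l : List (IwasawaAlgebra p)}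
    (h : ∀ x ∈ l, x ∉ augIdealP p) : l.prod ∉ augIdealP p := by
  induction l with
  | nil =>
    rw [List.prod_nil]
    exact fun h1 => (isPrime_augIdealP_holds p).ne_top ((Ideal.eq_top_iff_one _).mpr h1)
  | cons a t ih =>
    rw [List.prod_cons]
    intro hmem
    rcases (isPrime_augIdealP_holds p).mem_or_mem hmem with ha | ht
    · exact h a (List.mem_cons_self) ha
    · exact ih (fun x hx => h x (List.mem_cons_of_mem _ hx)) ht

/-- **`ℓ_{(p)}(Λ/(p^k·∏ fⱼ^{nⱼ})) = k` for distinguished `fⱼ`**: the local length at `(p)` of the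
cyclic module on the characteristic element (tree `charElement`) is the exponent of `p`.
[cite: Washington1997, §13.2] -/
private theorem lengthAt_quotient_charElement_augIdealP {μs : List ℕ} {fs : List (ℤ_[p][X] × ℕ)}
    (hfs : ∀ f ∈ fs, f.1.IsDistinguishedAt (IsLocalRing.maximalIdeal ℤ_[p]))
    (𝔭 : PrimeSpectrum (IwasawaAlgebra p)) (h𝔭 : 𝔭.asIdeal = augIdealP p) :
    Module.lengthAt (IwasawaAlgebra p) (IwasawaAlgebra p ⧸ Ideal.span {charElement p μs fs}) 𝔭 =
      μs.sum := by
  have h1 : 𝔭.asIdeal.height = 1 := by rw [h𝔭]; exact height_augIdealP_holds p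
  have hCmem : PowerSeries.C (p : ℤ_[p]) ∈ 𝔭.asIdeal := by
    rw [h𝔭]; exact Ideal.subset_span (Set.mem_singleton _)
  have hC : (PowerSeries.C ((p : ℤ_[p]) ^ μs.sum) : IwasawaAlgebra p) ≠ 0 := by
    rw [map_pow]; exact pow_ne_zero _ (prime_C p).ne_zero
  rw [charElement, Module.lengthAt_quotient_span_singleton_mul _ hC,
    lengthAt_quotient_C_pow μs.sum 𝔭 h1, if_pos hCmem,
    Module.lengthAt_quotient_eq_zero_of_not_le, add_zero, nsmul_one]
  -- the distinguished part generates an ideal not contained in `(p)`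
  rw [Ideal.span_singleton_le_iff_mem, h𝔭]
  refine list_prod_notMem_augIdealP fun x hx => ?_
  obtain ⟨f, hf, rfl⟩ := List.mem_map.mp hx
  intro hmem
  have := (isPrime_augIdealP_holds p).mem_of_pow_mem _ hmem
  exact coe_notMem_augIdealP_of_isDistinguishedAt p (hfs f hf) this

/-- **`μ(M) = μ(Λ/(g))` for a generator `g` of `char(M)`** (`M` finitely generated torsion):
Washington §13.2 — `μ` is the exponent of `p` in the characteristic power series. Via the
structure theorem: `M ∼ E(μs, fs)`, `char(M) = (p^{∑μᵢ}∏ fⱼ^{nⱼ}) = (g)`, `μ(M) = ∑ μᵢ =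
μ(Λ/(charElement)) = μ(Λ/(g))`. [cite: Washington1997, §13.2] -/
theorem muInvariant_eq_muInvariant_quotient_of_charIdeal_eq_span (M : Type) [AddCommGroup M]
    [Module (IwasawaAlgebra p) M] [Module.Finite (IwasawaAlgebra p) M]
    (hM : Module.IsTorsion (IwasawaAlgebra p) M) {g : IwasawaAlgebra p}
    (hg : Module.charIdeal (IwasawaAlgebra p) M = Ideal.span {g}) :
    muInvariant p M = muInvariant p (IwasawaAlgebra p ⧸ Ideal.span {g}) := by
  obtain ⟨μs, fs, -, hfs, hψ⟩ := exists_isPseudoIsomorphism_elementary_holds p M hM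
  have hfs' : ∀ f ∈ fs, f.1.IsDistinguishedAt (IsLocalRing.maximalIdeal ℤ_[p]) :=
    fun f hf => (hfs f hf).1
  have hchar : Module.charIdeal (IwasawaAlgebra p) M = Ideal.span {charElement p μs fs} :=
    charIdeal_eq_span_holds p M hfs' hψ
  have hμ : muInvariant p M = μs.sum := muInvariant_eq_sum_holds p M hfs' hψ
  have hspan : Ideal.span {g} = Ideal.span {charElement p μs fs} := hg.symm.trans hchar
  let 𝔭 : PrimeSpectrum (IwasawaAlgebra p) := ⟨augIdealP p, isPrime_augIdealP_holds p⟩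
  rw [hμ, muInvariant_eq_toNat_lengthAt p _ 𝔭 rfl,
    Module.lengthAt_eq_of_linearEquiv (Submodule.quotEquivOfEq _ _ hspan) 𝔭,
    lengthAt_quotient_charElement_augIdealP hfs' 𝔭 rfl, ENat.toNat_coe]

/-- **`μ(Λ/(p^k·a)) = k + μ(Λ/(a))`** for `a ≠ 0`. [cite: Washington1997, §13.2] -/
theorem muInvariant_quotient_pow_mul {a : IwasawaAlgebra p} (ha : a ≠ 0) (k : ℕ) :
    muInvariant p (IwasawaAlgebra p ⧸ Ideal.span {(p : IwasawaAlgebra p) ^ k * a}) =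
      k + muInvariant p (IwasawaAlgebra p ⧸ Ideal.span {a}) := by
  let 𝔭 : PrimeSpectrum (IwasawaAlgebra p) := ⟨augIdealP p, isPrime_augIdealP_holds p⟩
  have h1 : 𝔭.asIdeal.height = 1 := height_augIdealP_holds p
  have hCmem : PowerSeries.C (p : ℤ_[p]) ∈ 𝔭.asIdeal := Ideal.subset_span (Set.mem_singleton _)
  have hpk : ((p : IwasawaAlgebra p) ^ k) = PowerSeries.C ((p : ℤ_[p]) ^ k) := by
    rw [map_pow, map_natCast]
  have hC : (PowerSeries.C ((p : ℤ_[p]) ^ k) : IwasawaAlgebra p) ≠ 0 := by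
    rw [map_pow]; exact pow_ne_zero _ (prime_C p).ne_zero
  have hfin : Module.lengthAt (IwasawaAlgebra p) (IwasawaAlgebra p ⧸ Ideal.span {a}) 𝔭 ≠ ⊤ :=
    lengthAt_ne_top_of_isTorsion p _ (isTorsion_quotient_span_singleton ha) 𝔭 rfl
  rw [muInvariant_eq_toNat_lengthAt p _ 𝔭 rfl, muInvariant_eq_toNat_lengthAt p _ 𝔭 rfl, hpk,
    Module.lengthAt_quotient_span_singleton_mul _ hC, lengthAt_quotient_C_pow k 𝔭 h1,
    if_pos hCmem, nsmul_one, ENat.toNat_add (ENat.coe_ne_top k) hfin, ENat.toNat_coe]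

/-- `(x)·(y) = (x·y)`. [folklore] -/
private theorem span_mul_span' (x y : IwasawaAlgebra p) :
    Ideal.span {x} * Ideal.span {y} = Ideal.span ({x * y} : Set (IwasawaAlgebra p)) :=
  Ideal.span_singleton_mul_span_singleton x y

/-- **The `μ`-criterion.** For a finitely generated torsion `Λ`-module `X` and `L ≠ 0` with
`(p^b)·char(X) = (p^a)·(L)` (characteristic ideals equal up to powers of `p`, as §3 outputs):
`char(X) = (L) ⟺ μ(X) = μ(Λ/(L))`. (⇒: `μ` is read off the characteristic ideal; ⇐: comparing
`μ` on both sides of `(p^b g) = (p^a L)` gives `b + μ(X) = a + μ(Λ/(L))`, so `a = b`, and the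
non-zero principal ideal `(p^a)` cancels.) [cite: Washington1997, §13.2] -/
theorem charIdeal_eq_span_iff_muInvariant_eq (X : Type) [AddCommGroup X]
    [Module (IwasawaAlgebra p) X] [Module.Finite (IwasawaAlgebra p) X]
    (hX : Module.IsTorsion (IwasawaAlgebra p) X) {L : IwasawaAlgebra p} (hL : L ≠ 0) {a b : ℕ}
    (hab : Ideal.span {(p : IwasawaAlgebra p) ^ b} * Module.charIdeal (IwasawaAlgebra p) X =
      Ideal.span {(p : IwasawaAlgebra p) ^ a} * Ideal.span {L}) :
    Module.charIdeal (IwasawaAlgebra p) X = Ideal.span {L} ↔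
      muInvariant p X = muInvariant p (IwasawaAlgebra p ⧸ Ideal.span {L}) := by
  constructor
  · intro h
    exact muInvariant_eq_muInvariant_quotient_of_charIdeal_eq_span X hX h
  · intro hμ
    obtain ⟨g, hg0, hg⟩ := exists_charIdeal_eq_span_ne_zero (p := p) X
    have hμg : muInvariant p X = muInvariant p (IwasawaAlgebra p ⧸ Ideal.span {g}) :=
      muInvariant_eq_muInvariant_quotient_of_charIdeal_eq_span X hX hg
    -- `(p^b g) = (p^a L)` as ideals, hence equal `μ`: `b + μ(Λ/(g)) = a + μ(Λ/(L))`
    have hideal : Ideal.span {(p : IwasawaAlgebra p) ^ b * g} =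
        Ideal.span {(p : IwasawaAlgebra p) ^ a * L} := by
      rw [← span_mul_span', ← span_mul_span', ← hg, hab]
    let 𝔭 : PrimeSpectrum (IwasawaAlgebra p) := ⟨augIdealP p, isPrime_augIdealP_holds p⟩
    have hμ2 : muInvariant p (IwasawaAlgebra p ⧸ Ideal.span {(p : IwasawaAlgebra p) ^ b * g}) =
        muInvariant p (IwasawaAlgebra p ⧸ Ideal.span {(p : IwasawaAlgebra p) ^ a * L}) := by
      rw [muInvariant_eq_toNat_lengthAt p _ 𝔭 rfl, muInvariant_eq_toNat_lengthAt p _ 𝔭 rfl,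
        Module.lengthAt_eq_of_linearEquiv (Submodule.quotEquivOfEq _ _ hideal) 𝔭]
    rw [muInvariant_quotient_pow_mul hg0, muInvariant_quotient_pow_mul hL, ← hμg, hμ] at hμ2
    have hba : b = a := by omega
    subst hba
    have hp0 : ((p : IwasawaAlgebra p) ^ b) ≠ 0 := by
      rw [← map_natCast (PowerSeries.C (R := ℤ_[p])) p]
      exact pow_ne_zero _ (prime_C p).ne_zero
    exact (Ideal.span_singleton_mul_right_inj hp0).mp hab

/-- **Item 19501 is the `μ`-equality (kernel).** For a CM curve in the frame of §3 (composed fact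
`h26`, Kobayashi's Thm. 2.2 at `η` `h22`, the displayed uniqueness `huniq` of the ideal
`(L_p⁺(V, η, X))`), every `Lp` with the interpolation property and every plus datum `D`:
Kobayashi's even main [C] at `η` — `D.charIdeal = (Lp)`, the conclusion of `PlusMCEtaK` verbatim —
holds IF AND ONLY IF `μ(X(D)) = μ(Λ/(Lp))`. The distinguished-polynomial part is print ([BT26]
Thm. 2.6 ∘ [Kob03] proof of Thm. 7.4, §3); the `μ`-part is what [BT26] Rem. 2.7 leaves open.
[cite: BurungaleTian2026, Thm. 2.6 and Rem. 2.7 (p. 5)] [cite: Kobayashi2003, §4 (p. 8), proof of Thm. 7.4 (p. 13), Thm. 2.2 (p. 5)]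
[cite: Washington1997, §13.2] -/
theorem evenEtaCharIdeal_eq_iff_muInvariant_eq_of_cm
    (h26 : thm26_etaKatoSequences_charIdeal_upToP_of_cm)
    (h22 : thm22_etaSignedSelmerDual_finite_torsion)
    (K₀ : Type) [Field K₀] [NumberField K₀] [IsCyclotomicExtension {p} ℚ K₀]
    [(galRange (K := ℚ) K₀).Normal] (η : absoluteGaloisGroup ℚ →* ℤˣ)
    (hη : ∀ σ ∈ galRange (K := ℚ) K₀, η σ = 1) (hη1 : η ≠ 1)
    (V : WeierstrassCurve ℚ) [V.IsElliptic] [V.IsGloballyMinimal] {N : ℕ} [NeZero N]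
    {f : CuspForm (Gamma0 N) 2} (hp : p ≠ 2) (hCM : V.HasCM) (hgood : V.HasGoodReductionAtPrime p)
    (hap : V.frobeniusTrace p = 0) (hf : IsNewformOf V f) (ϖ : ℚ)
    (hϖ : if Even (p / 2) then (ϖ : ℝ) * V.realPeriodRat = plusPeriod f
      else (ϖ : ℝ) * V.imaginaryPeriodRat = minusPeriod f)
    (huniq : ∀ L₁ L₂ : IwasawaAlgebra p, IsQuadraticBranchPlusLFunction f p ϖ L₁ →
      IsQuadraticBranchPlusLFunction f p ϖ L₂ → Ideal.span {L₁} = Ideal.span {L₂})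
    (κ : ZpExtension ℚ p) (γ : absoluteGaloisGroup ℚ) (hκ : κ.IsCyclotomic)
    (hγ : κ.IsTopGenerator γ) (hγK : γ ∈ galRange (K := ℚ) K₀) (hvar : IsCyclotomicVariable p γ)
    (Lp : IwasawaAlgebra p) (hLp : IsQuadraticBranchPlusLFunction f p ϖ Lp)
    (D : EtaSignedSelmerDualData V κ K₀ ℚ_[p] η γ 1) :
    D.charIdeal = Ideal.span {Lp} ↔
      muInvariant p D.X = muInvariant p (IwasawaAlgebra p ⧸ Ideal.span {Lp}) := by
  obtain ⟨a, b, hab⟩ := evenEtaCharIdeal_eq_upToP_of_cm_of_unique h26 h22 K₀ η hη hη1 V hp hCM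
    hgood hap hf ϖ hϖ huniq κ γ hκ hγ hγK hvar Lp hLp D
  obtain ⟨hfin, htors⟩ := h22 p K₀ η hη V hp hgood hap κ γ hκ hγ hγK 1 D
  -- `Lp ≠ 0`: from the package's own `Lp₀ ≠ 0` (read off the sequence) and `(Lp) = (Lp₀)`
  have hL : Lp ≠ 0 := by
    obtain ⟨A, B, _, _, _, _, ⟨-, hAtors⟩, -, -, ⟨Lp₀, hLp₀, hS⟩, -⟩ :=
      h26 p K₀ η hη hη1 V hp hCM hgood hap hf ϖ hϖ κ γ hκ hγ hγK hvar
    obtain ⟨i, j, k, -, hij, -, -⟩ := hS D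
    have h0 : Lp₀ ≠ 0 := ne_zero_of_fourTermExact_of_isTorsion hAtors htors i j hij
    intro hz
    have := huniq Lp Lp₀ hLp hLp₀
    rw [hz, Ideal.span_singleton_eq_span_singleton] at this
    exact h0 (associated_zero_iff_eq_zero _ |>.mp this.symm)
  haveI := hfin
  exact charIdeal_eq_span_iff_muInvariant_eq D.X htors hL hab

end MuCriterion

/-! ## §5 (appended, proofs only) The ODD-side twins: the `∀ Lm` form and the `μ`-criterion for
Kobayashi's odd main [C] at `η ≠ 1`

[Kob03] §4 (p. 8), verbatim: «[C] (Odd main [C]). … If `η` is non-trivial,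
`Char(X⁻(E/K_∞)^η) = ((1/X)L⁻_p(E, η, X))`. (By (3.7), the `p`-adic `L`-function `L⁻_p(E, η, X)` is
divisible by `X`.)» In the tree's currency (the sibling facts and the K8-inert route's odd readings):
for `Lm` with the interpolation property of `L_p⁻(V, η, X)` and `L'` with `Lm = X·L'`, the odd main
[C] at `η` for a minus datum `D` reads `D.charIdeal = (L')`. §3 gave it up to powers of `p` for a CM
`V` (for the package's OWN `Lm`); here, exactly as §3/§4 did on the even side, (i) the `∀ Lm` form
under the DISPLAYED uniqueness of the ideal `(L_p⁻(V, η, X))` among all `Lm` with the interpolation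
property (hypothesis `huniq`, not asserted; Summits-side it is
`Additive.IsQuadraticBranchMinusLFunction.span_singleton_eq`-shaped), and (ii) the `μ`-criterion: the
odd main [C] at `η` holds IF AND ONLY IF `μ(X⁻(V/K_∞)^η) = μ(Λ/(L'))`. Nothing new is asserted; no
new fact; net debt 0. -/

section OddMuCriterion

open Literature.NumberTheory.EllipticCurves.IwasawaAlgebra

variable {p : ℕ} [Fact p.Prime]

/-- **The `∀ Lm` form of the odd statement**, under the DISPLAYED uniqueness `huniq` of the ideal
`(L_p⁻(V, η, X))` among all `Lm` with the interpolation property (3.5)+(3.7): for a CM `V` in the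
frame of §3, every such `Lm`, every `L'` with `Lm = X·L'` and every minus datum `D` of
`Sel⁻(V/K_∞)^η`: `(p^b)·Char(X(D)) = (p^a)·(L')` for some `a b` — Kobayashi's odd main [C] at
`η ≠ 1` («`Char(X⁻(E/K_∞)^η) = ((1/X)L⁻_p(E, η, X))`», §4 p. 8) with the `μ`-part removed. (From §3's
package `Lm₀`: `(Lm) = (Lm₀)` gives `Lm₀ = Lm·u = X·(L'·u)` for a unit `u`, and `(L'·u) = (L')`.)
[cite: BurungaleTian2026, Thm. 2.6 (p. 5)] [cite: Kobayashi2003, §4 odd main [C] (p. 8), proof of Thm. 7.4 (p. 13), (3.7) (p. 7)] -/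
theorem oddEtaCharIdeal_eq_upToP_of_cm_of_unique
    (h26 : thm26_etaKatoSequences_charIdeal_upToP_of_cm)
    (h22 : thm22_etaSignedSelmerDual_finite_torsion)
    (K₀ : Type) [Field K₀] [NumberField K₀] [IsCyclotomicExtension {p} ℚ K₀]
    [(galRange (K := ℚ) K₀).Normal] (η : absoluteGaloisGroup ℚ →* ℤˣ)
    (hη : ∀ σ ∈ galRange (K := ℚ) K₀, η σ = 1) (hη1 : η ≠ 1)
    (V : WeierstrassCurve ℚ) [V.IsElliptic] [V.IsGloballyMinimal] {N : ℕ} [NeZero N]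
    {f : CuspForm (Gamma0 N) 2} (hp : p ≠ 2) (hCM : V.HasCM) (hgood : V.HasGoodReductionAtPrime p)
    (hap : V.frobeniusTrace p = 0) (hf : IsNewformOf V f) (ϖ : ℚ)
    (hϖ : if Even (p / 2) then (ϖ : ℝ) * V.realPeriodRat = plusPeriod f
      else (ϖ : ℝ) * V.imaginaryPeriodRat = minusPeriod f)
    (huniq : ∀ L₁ L₂ : IwasawaAlgebra p, IsQuadraticBranchMinusLFunction f p ϖ L₁ →
      IsQuadraticBranchMinusLFunction f p ϖ L₂ → Ideal.span {L₁} = Ideal.span {L₂})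
    (κ : ZpExtension ℚ p) (γ : absoluteGaloisGroup ℚ) (hκ : κ.IsCyclotomic)
    (hγ : κ.IsTopGenerator γ) (hγK : γ ∈ galRange (K := ℚ) K₀) (hvar : IsCyclotomicVariable p γ)
    (Lm : IwasawaAlgebra p) (hLm : IsQuadraticBranchMinusLFunction f p ϖ Lm)
    (L' : IwasawaAlgebra p) (hL' : Lm = PowerSeries.X * L')
    (D : EtaSignedSelmerDualData V κ K₀ ℚ_[p] η γ (-1)) :
    ∃ a b : ℕ, Ideal.span {(p : IwasawaAlgebra p) ^ b} * D.charIdeal =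
      Ideal.span {(p : IwasawaAlgebra p) ^ a} * Ideal.span {L'} := by
  obtain ⟨Lm₀, hLm₀, h⟩ := oddEtaCharIdeal_eq_upToP_of_cm h26 h22 K₀ η hη hη1 V hp hCM hgood hap
    hf ϖ hϖ κ γ hκ hγ hγK hvar
  -- `(Lm) = (Lm₀)`, so `Lm₀ = Lm * u` for a unit `u`, i.e. `Lm₀ = X * (L' * u)`
  obtain ⟨u, hu⟩ := Ideal.span_singleton_eq_span_singleton.mp (huniq Lm Lm₀ hLm hLm₀)
  have hLm₀' : Lm₀ = PowerSeries.X * (L' * (u : IwasawaAlgebra p)) := by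
    rw [← hu, hL', mul_assoc]
  obtain ⟨a, b, hab⟩ := h D (L' * (u : IwasawaAlgebra p)) hLm₀'
  refine ⟨a, b, ?_⟩
  rw [hab, Ideal.span_singleton_mul_right_unit u.isUnit]

/-- **The odd main [C] at `η ≠ 1` is the `μ`-equality (kernel).** For a CM curve in the frame of §3
(composed fact `h26`, Kobayashi's Thm. 2.2 at `η` `h22`, the displayed uniqueness `huniq` of the
ideal `(L_p⁻(V, η, X))`), every `Lm` with the interpolation property, every `L'` with `Lm = X·L'`
and every minus datum `D`: Kobayashi's odd main [C] at `η` — `D.charIdeal = (L')`, i.e.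
«`Char(X⁻(E/K_∞)^η) = ((1/X)L⁻_p(E, η, X))`» (§4 p. 8) in the tree's currency — holds IF AND ONLY
IF `μ(X(D)) = μ(Λ/(L'))`. The distinguished-polynomial part is print ([BT26] Thm. 2.6 ∘ [Kob03]
proof of Thm. 7.4, §3); the `μ`-part is what [BT26] Rem. 2.7 leaves open. Twin of
`evenEtaCharIdeal_eq_iff_muInvariant_eq_of_cm`.
[cite: BurungaleTian2026, Thm. 2.6 and Rem. 2.7 (p. 5)] [cite: Kobayashi2003, §4 (p. 8), proof of Thm. 7.4 (p. 13), Thm. 2.2 (p. 5), (3.7) (p. 7)]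
[cite: Washington1997, §13.2] -/
theorem oddEtaCharIdeal_eq_iff_muInvariant_eq_of_cm
    (h26 : thm26_etaKatoSequences_charIdeal_upToP_of_cm)
    (h22 : thm22_etaSignedSelmerDual_finite_torsion)
    (K₀ : Type) [Field K₀] [NumberField K₀] [IsCyclotomicExtension {p} ℚ K₀]
    [(galRange (K := ℚ) K₀).Normal] (η : absoluteGaloisGroup ℚ →* ℤˣ)
    (hη : ∀ σ ∈ galRange (K := ℚ) K₀, η σ = 1) (hη1 : η ≠ 1)
    (V : WeierstrassCurve ℚ) [V.IsElliptic] [V.IsGloballyMinimal] {N : ℕ} [NeZero N]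
    {f : CuspForm (Gamma0 N) 2} (hp : p ≠ 2) (hCM : V.HasCM) (hgood : V.HasGoodReductionAtPrime p)
    (hap : V.frobeniusTrace p = 0) (hf : IsNewformOf V f) (ϖ : ℚ)
    (hϖ : if Even (p / 2) then (ϖ : ℝ) * V.realPeriodRat = plusPeriod f
      else (ϖ : ℝ) * V.imaginaryPeriodRat = minusPeriod f)
    (huniq : ∀ L₁ L₂ : IwasawaAlgebra p, IsQuadraticBranchMinusLFunction f p ϖ L₁ →
      IsQuadraticBranchMinusLFunction f p ϖ L₂ → Ideal.span {L₁} = Ideal.span {L₂})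
    (κ : ZpExtension ℚ p) (γ : absoluteGaloisGroup ℚ) (hκ : κ.IsCyclotomic)
    (hγ : κ.IsTopGenerator γ) (hγK : γ ∈ galRange (K := ℚ) K₀) (hvar : IsCyclotomicVariable p γ)
    (Lm : IwasawaAlgebra p) (hLm : IsQuadraticBranchMinusLFunction f p ϖ Lm)
    (L' : IwasawaAlgebra p) (hL' : Lm = PowerSeries.X * L')
    (D : EtaSignedSelmerDualData V κ K₀ ℚ_[p] η γ (-1)) :
    D.charIdeal = Ideal.span {L'} ↔
      muInvariant p D.X = muInvariant p (IwasawaAlgebra p ⧸ Ideal.span {L'}) := by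
  obtain ⟨a, b, hab⟩ := oddEtaCharIdeal_eq_upToP_of_cm_of_unique h26 h22 K₀ η hη hη1 V hp hCM
    hgood hap hf ϖ hϖ huniq κ γ hκ hγ hγK hvar Lm hLm L' hL' D
  obtain ⟨hfin, htors⟩ := h22 p K₀ η hη V hp hgood hap κ γ hκ hγ hγK (-1) D
  -- `L' ≠ 0`: the package's own `Lm₀ = X·(L'·u)` has `L'·u ≠ 0` (read off its sequence)
  have hL : L' ≠ 0 := by
    obtain ⟨A, B, _, _, _, _, ⟨-, hAtors⟩, -, -, -, ⟨Lm₀, hLm₀, hS⟩⟩ :=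
      h26 p K₀ η hη hη1 V hp hCM hgood hap hf ϖ hϖ κ γ hκ hγ hγK hvar
    obtain ⟨u, hu⟩ := Ideal.span_singleton_eq_span_singleton.mp (huniq Lm Lm₀ hLm hLm₀)
    have hLm₀' : Lm₀ = PowerSeries.X * (L' * (u : IwasawaAlgebra p)) := by
      rw [← hu, hL', mul_assoc]
    obtain ⟨i, j, k, -, hij, -, -⟩ := hS D (L' * (u : IwasawaAlgebra p)) hLm₀'
    have h0 : L' * (u : IwasawaAlgebra p) ≠ 0 :=
      ne_zero_of_fourTermExact_of_isTorsion hAtors htors i j hij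
    intro hz
    exact h0 (by rw [hz, zero_mul])
  haveI := hfin
  exact charIdeal_eq_span_iff_muInvariant_eq D.X htors hL hab

end OddMuCriterion

end Literature.NumberTheory.EllipticCurves.BurungaleTian2026

end
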